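import Summits.Schanuel.Schanuel.Theorems.RootDecomp1HCurveHull
import Summits.Schanuel.Schanuel.Theorems.RootDecomp1HStoreys
import Summits.Schanuel.Schanuel.Theorems.RootDecomp1EAnchorToolkit

/-!
# RootDecomp1E ∩ RootDecomp1H — CONVERGENCE (d): the residual `DeepLogDarkAtomSchanuel` (lens-2 node N2, item
# stmt-Schanuel-30284 of route RootDecomp1E) AGAINST the tower pieces of route RootDecomp1H (lens-5 node N5b:
# `ProductSchanuel`, `AlmostProductSchanuel` 29909, `DeepTowerSchanuel` 29910)

TREE.md v0.9.18 records CONVERGENCE (d) as owed «beyond the type level»: inclusions or separating cells between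
`DeepLogDarkAtomSchanuel` (DLDK), `DeepTowerSchanuel` / `BridgeTransverse` and `Cᵉ`.  This file is the kernel part
lens-2 can certify with landed API only (no new definitions of record, no instances, no notation, 0 sorry):

* §2 `hullField hTS`: under `TowerSchanuel` (`= ProductSchanuel ∧ RelTowerSchanuel`, landed
  `towerSchanuel_iff_structural`; `= ProductSchanuel ∧ AlmostProductSchanuel ∧ DeepTowerSchanuel` through the landed
  glue `relTowerSchanuelGlue_holds`) the tower hull `𝒯̂ = towerHullSet` of 1H is an INTERMEDIATE FIELD closed under
  `exp`, under all logarithms and relatively algebraically closed in `ℂ`; hence **`𝕃 ≤ 𝒯̂`**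
  (`closedFormField_le_hullField`): 1E's closed-form field (the inlined `sInf` of items 27517/30099/30283/30284) sits
  inside 1H's hull.
* §3 **HULL-CORANK LEMMA** `le_trdeg_of_hullCorank_le_two`: under `TowerSchanuel`, Schanuel holds at every ℚ-free
  SPAN-MINIMAL tuple `z` (1E's binder) whose ℚ-span contains a ℚ-free tuple of hull numbers of corank `≤ 2`
  (`n ≤ a + 2`).  Mechanism: span-minimality bounds the base field from below, the failure bounds the total from
  above, so each of the (at most two) missing coordinates is a CURVE POINT over a hull field (`CurveCond`), hence in
  the hull (landed `curve_mem_towerHullSet`); then the landed hull theorem decides `z`.  Corank `3` is where the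
  count breaks (the first transcendental step may cost `2`): that is the content of the placement below.
* §4 COROLLARIES IN ITEM SHAPE: `deepLogDark_of_rank_le_four` — `TowerSchanuel` decides every instance of DLDK of
  rank `n ≤ 4` (of DLDK's seven binders only ℚ-freeness, the DEEP ANCHOR PAIR `x, y ∈ 𝕃` and span-minimality are
  used); `deepLogDarkAtomSchanuel_iff_rank_ge_five` — under `TowerSchanuel`, item 30284 is EQUIVALENT to its own
  restriction to rank `≥ 5`, and (`deepLogDarkAtomSchanuel_of_hullCorank_ge_three`) it REDUCES VERBATIM to the tuples of
  hull-corank `≥ 3` (every free hull tuple in the span has length `≤ n - 3`); `deepLogDark_of_rank_le_four_of_pieces` —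
  the rank-`≤ 4` statement from the three 1H pieces.
* §5 APS LEVEL (no `DeepTowerSchanuel`): `le_trdeg_of_atomicCorank_one` — `ProductSchanuel ∧ AlmostProductSchanuel`
  decide every ℚ-free `z` of rank `m + 1` whose span contains `m` ℚ-free DEPTH-ONE numbers; in particular DLDK's
  declared first cell `(iπ, π, ζ₀, conj ζ₀)` (`e^{ζ₀} = ζ₀`) is an `AlmostProductSchanuel` cell
  (`firstCell_of_prod_aps`), and its log-anchored variant `(iπ, log 2, ζ₀, conj ζ₀)` a `ProductSchanuel` cell.
* §6 SEPARATION AT THE TYPE LEVEL, made checkable: the named first cells of 1H's residual side, `(1, e, e^e)` and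
  `(iπ, π, e^π)`, have ALL coordinates in `𝕃` — they are NOT dark, i.e. they lie on 1E's `ClosedFormAtomSchanuel`
  (27517) side and never meet DLDK.

PLACEMENT (bookkeeping, no decision credit): DLDK ∩ {hull-corank ≤ 2} ⊇ DLDK ∩ {rank ≤ 4} lies in
cone(ProductSchanuel, AlmostProductSchanuel, DeepTowerSchanuel) by kernel; under `TowerSchanuel` DLDK's genuinely residual
layer is {rank n ≥ 5, hull rank dim(span_ℚ z ∩ 𝒯̂) ∈ [2, n − 3]}: at least three coordinates of any adapted basis lie
OFF the hull — the domain of 1H's residual `BridgeTransverse` (30564, «a coordinate off 𝓚 = 𝒯̂»), on which no kernel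
inclusion either way is claimed.  Service file of lens-2 (gen 26) for TREE (d); imports landed modules only.
-/


noncomputable section

namespace Summit.Schanuel.Schanuel.Theorems.RootDecomp1EHullCorank

open Complex Set IntermediateField
open Summit.Schanuel.Schanuel.Theses.RootDecomp1E (DeepLogDarkAtomSchanuel)
open Summit.Schanuel.Schanuel.Theses.RootDecomp1H (ProductSchanuel RelTowerSchanuel AlmostProductSchanuel
  DeepTowerSchanuel)
open Summit.Schanuel.Schanuel.Theorems.RootDecomp1EAnchor (closedFormField SpanMinimal Saturated Dark AlgFree
  mem_closedFormField_iff exp_mem_closedFormField mem_closedFormField_of_exp_mem isAlgebraic_of_mem_adjoin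
  isAlgebraic_of_le mem_closedFormField_of_isAlgebraic_closedFormField exists_nat_lt_of_lt_natCast
  exists_nat_eq_of_le_natCast span_range_le trdeg_le_of_mem_span trdeg_eq_of_span_eq mem_closedFormField_of_mem_span)
open Summit.Schanuel.Schanuel.Theorems.RootDecomp1HCurveHull (TowerTuple TowerSchanuel towerSchanuel_of_structural
  towerSchanuel_iff_structural CurveCond towerHullSet towerHull mem_towerHull_iff mem_towerHullSet_of_depthOne
  add_mem_towerHullSet smul_mem_towerHullSet zero_mem_towerHullSet exists_tower_of_mem_towerHullSet
  curve_mem_towerHullSet exp_mem_towerHullSet mem_towerHullSet_of_exp_mem range_snoc_union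
  trdeg_adjoin_le_one_of_subsingleton depthOne_of_isAlgebraic depthOne_of_isAlgebraic_exp towerSchanuel_of_schanuel)
open Summit.Schanuel.Schanuel.Theorems.RootDecomp1HTowerCells (trdeg_adjoin_adjoin_eq)
open Summit.Schanuel.Schanuel.Theorems.RootDecomp1HHull (hull_of_product_of_relTower)
open Summit.Schanuel.Schanuel.Theorems.RootDecomp1HStoreys (exists_snoc_span_eq relTowerSchanuelGlue_holds)
open Summit.Schanuel.Schanuel.Theorems.RootDecomp1DFlagSplit (trdeg_adjoin_union_eq_add trdeg_adjoin_le_cardinalMk)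
open Literature.NumberTheory.Transcendental (OneMotiveToric.trdeg_mono trdeg_adjoin_le_of_le)

/-! ## 1. Relative depth: the curve condition for algebraic points and from a transcendence-degree sandwich -/

/-- A point ALGEBRAIC over the field `ℚ(Y, e^Y)` satisfies 1J's curve condition over `Y` (relative depth `≤ 1`). -/
theorem curveCond_of_isAlgebraic (Y : Finset ℂ) {g : ℂ}
    (hg : IsAlgebraic ↥(adjoin ℚ ((↑Y : Set ℂ) ∪ cexp '' ↑Y)) g) : CurveCond Y g := by
  unfold CurveCond
  set F : IntermediateField ℚ ℂ := adjoin ℚ ((↑Y : Set ℂ) ∪ cexp '' ↑Y)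
  rw [Set.insert_eq g ({cexp g} : Set ℂ)]
  have h0 : Algebra.trdeg ↥F ↥(adjoin ↥F ({g} : Set ℂ)) = 0 := by
    haveI : Algebra.IsAlgebraic ↥F ↥(adjoin ↥F ({g} : Set ℂ)) :=
      IntermediateField.isAlgebraic_adjoin fun x hx => by
        rw [Set.mem_singleton_iff.mp hx]; exact hg.isIntegral
    exact trdeg_eq_zero
  calc Algebra.trdeg ↥F ↥(adjoin ↥F (({g} : Set ℂ) ∪ {cexp g}))
      = Algebra.trdeg ↥F ↥(adjoin ↥F ({g} : Set ℂ)) +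
          Algebra.trdeg ↥(adjoin ↥F ({g} : Set ℂ)) ↥(adjoin ↥(adjoin ↥F ({g} : Set ℂ)) ({cexp g} : Set ℂ)) :=
        trdeg_adjoin_union_eq_add (K := ↥F) _ _
    _ ≤ 0 + 1 := by
        rw [h0]
        refine add_le_add le_rfl ?_
        calc Algebra.trdeg ↥(adjoin ↥F ({g} : Set ℂ)) ↥(adjoin ↥(adjoin ↥F ({g} : Set ℂ)) ({cexp g} : Set ℂ))
            ≤ Cardinal.mk ({cexp g} : Set ℂ) := trdeg_adjoin_le_cardinalMk _
          _ = 1 := Cardinal.mk_singleton _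
    _ = 1 := zero_add 1

/-- THE SANDWICH, abstract form: `m ≤ trdeg ℚ(S)` and `trdeg ℚ(S ∪ T) ≤ m + 1` force relative depth
`trdeg_{ℚ(S)} ℚ(S)(T) ≤ 1` (tower law; all degrees are finite here).  Stated by `calc` steps only, since the two
`Algebra ℚ ↥(adjoin ℚ S)` instance paths are merely defeq. -/
theorem rel_le_one_of_sandwich {S T : Set ℂ} {m : ℕ}
    (hlow : (m : Cardinal) ≤ Algebra.trdeg ℚ ↥(adjoin ℚ S))
    (hup : Algebra.trdeg ℚ ↥(adjoin ℚ (S ∪ T)) ≤ ((m + 1 : ℕ) : Cardinal)) :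
    Algebra.trdeg ↥(adjoin ℚ S) ↥(adjoin ↥(adjoin ℚ S) T) ≤ 1 := by
  have htower := trdeg_adjoin_adjoin_eq (K := ℚ) S T
  obtain ⟨t, ht, -⟩ := exists_nat_eq_of_le_natCast hup
  have hB : Algebra.trdeg ℚ ↥(adjoin ℚ S) ≤ (t : Cardinal) := by
    calc Algebra.trdeg ℚ ↥(adjoin ℚ S) ≤ _ := le_self_add
      _ = _ := htower
      _ = (t : Cardinal) := ht
  obtain ⟨s, hs, -⟩ := exists_nat_eq_of_le_natCast hB
  have hR : Algebra.trdeg ↥(adjoin ℚ S) ↥(adjoin ↥(adjoin ℚ S) T) ≤ (t : Cardinal) := by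
    calc Algebra.trdeg ↥(adjoin ℚ S) ↥(adjoin ↥(adjoin ℚ S) T) ≤ _ := le_add_self
      _ = _ := htower
      _ = (t : Cardinal) := ht
  obtain ⟨r, hr, -⟩ := exists_nat_eq_of_le_natCast hR
  have hsum : (s : Cardinal) + (r : Cardinal) = (t : Cardinal) := by
    calc (s : Cardinal) + (r : Cardinal)
        = Algebra.trdeg ℚ ↥(adjoin ℚ S) + Algebra.trdeg ↥(adjoin ℚ S) ↥(adjoin ↥(adjoin ℚ S) T) := by rw [hs, hr]
      _ = _ := htower
      _ = (t : Cardinal) := ht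
  have h1 : m ≤ s := by exact_mod_cast hlow.trans hs.le
  have h2 : t ≤ m + 1 := by exact_mod_cast ht.symm.le.trans hup
  have h3 : s + r = t := by exact_mod_cast hsum
  have h4 : r ≤ 1 := by omega
  calc Algebra.trdeg ↥(adjoin ℚ S) ↥(adjoin ↥(adjoin ℚ S) T) = (r : Cardinal) := hr
    _ ≤ 1 := by exact_mod_cast h4

/-- THE SANDWICH: if `trdeg ℚ(w, e^w) ≥ m` and `trdeg ℚ(w, g, e^w, e^g) ≤ m + 1` then `(g, e^g)` has relative depth
`≤ 1` over `ℚ(w, e^w)`, so — under `TowerSchanuel` and with `w` in the hull — `g` lies in the tower hull `𝒯̂`. -/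
theorem mem_towerHullSet_of_sandwich (hTS : TowerSchanuel) {m : ℕ} {w : Fin m → ℂ} {g : ℂ}
    (hw : ∀ j, w j ∈ towerHullSet)
    (hlow : (m : Cardinal) ≤ Algebra.trdeg ℚ ↥(adjoin ℚ (range w ∪ range (cexp ∘ w))))
    (hup : Algebra.trdeg ℚ ↥(adjoin ℚ (range (Fin.snoc w g : Fin (m + 1) → ℂ) ∪
      range (cexp ∘ (Fin.snoc w g : Fin (m + 1) → ℂ)))) ≤ ((m + 1 : ℕ) : Cardinal)) :
    g ∈ towerHullSet := by
  classical
  set Y : Finset ℂ := Finset.univ.image w with hYdef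
  have hYS : (↑Y : Set ℂ) ∪ cexp '' ↑Y = range w ∪ range (cexp ∘ w) := by
    rw [hYdef, Finset.coe_image, Finset.coe_univ, Set.image_univ, ← Set.range_comp]
  have hY : (↑Y : Set ℂ) ⊆ towerHullSet := by
    intro x hx
    obtain ⟨i, -, rfl⟩ := Finset.mem_image.mp (Finset.mem_coe.mp hx)
    exact hw i
  refine curve_mem_towerHullSet hTS Y hY ?_
  -- the curve condition over `Y`, computed over the generating set `range w ∪ range (e^w)`
  rw [RootDecomp1HCurveHull.curveCond_iff_of_eq hYS]
  have hmono : Algebra.trdeg ℚ ↥(adjoin ℚ ((range w ∪ range (cexp ∘ w)) ∪ {g, cexp g})) ≤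
      ((m + 1 : ℕ) : Cardinal) := by
    refine le_trans (OneMotiveToric.trdeg_mono (IntermediateField.adjoin.mono ℚ _ _ ?_)) hup
    rw [range_snoc_union w g]
  exact rel_le_one_of_sandwich hlow hmono

/-! ## 2. Under `TowerSchanuel` the tower hull `𝒯̂` is an exp/log-closed, relatively algebraically closed field ⊇ 𝕃 -/

/-- `𝒯̂` is closed under multiplication (a product is ALGEBRAIC over the field of its factors: a curve point). -/
theorem mul_mem_towerHullSet (hTS : TowerSchanuel) {x y : ℂ} (hx : x ∈ towerHullSet) (hy : y ∈ towerHullSet) :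
    x * y ∈ towerHullSet := by
  classical
  refine curve_mem_towerHullSet hTS ({x, y} : Finset ℂ) ?_ (curveCond_of_isAlgebraic _ ?_)
  · intro z hz
    rcases Finset.mem_insert.mp (Finset.mem_coe.mp hz) with rfl | hz
    · exact hx
    · rw [Finset.mem_singleton.mp hz]; exact hy
  · refine isAlgebraic_of_mem_adjoin (mul_mem ?_ ?_)
    · exact subset_adjoin ℚ _ (Or.inl (Finset.mem_coe.mpr (Finset.mem_insert_self x _)))
    · exact subset_adjoin ℚ _ (Or.inl (Finset.mem_coe.mpr (Finset.mem_insert_of_mem (Finset.mem_singleton_self y))))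

/-- `𝒯̂` is closed under inverses. -/
theorem inv_mem_towerHullSet (hTS : TowerSchanuel) {x : ℂ} (hx : x ∈ towerHullSet) : x⁻¹ ∈ towerHullSet := by
  classical
  refine curve_mem_towerHullSet hTS ({x} : Finset ℂ) ?_ (curveCond_of_isAlgebraic _ ?_)
  · intro z hz
    rw [Finset.coe_singleton, Set.mem_singleton_iff] at hz
    rw [hz]; exact hx
  · exact isAlgebraic_of_mem_adjoin (inv_mem (subset_adjoin ℚ _ (Or.inl (Finset.mem_coe.mpr (Finset.mem_singleton_self x)))))

/-- Algebraic numbers lie in `𝒯̂` (depth one). -/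
theorem mem_towerHullSet_of_isAlgebraic {x : ℂ} (hx : IsAlgebraic ℚ x) : x ∈ towerHullSet :=
  mem_towerHullSet_of_depthOne (depthOne_of_isAlgebraic hx)

/-- **THE HULL FIELD** (under `TowerSchanuel`): the tower hull `𝒯̂` as an intermediate field `ℚ ≤ 𝒯̂ ≤ ℂ`. -/
def hullField (hTS : TowerSchanuel) : IntermediateField ℚ ℂ where
  carrier := towerHullSet
  mul_mem' := fun ha hb => mul_mem_towerHullSet hTS ha hb
  one_mem' := mem_towerHullSet_of_isAlgebraic isAlgebraic_one
  add_mem' := fun ha hb => add_mem_towerHullSet hTS ha hb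
  zero_mem' := zero_mem_towerHullSet
  algebraMap_mem' := fun r => mem_towerHullSet_of_isAlgebraic (isAlgebraic_algebraMap r)
  inv_mem' := fun _ ha => inv_mem_towerHullSet hTS ha

/-- Membership in the hull field is membership in `towerHullSet` (`Iff.rfl`). -/
theorem mem_hullField_iff (hTS : TowerSchanuel) {x : ℂ} : x ∈ hullField hTS ↔ x ∈ towerHullSet := Iff.rfl

/-- The hull field is closed under `exp` … -/
theorem exp_mem_hullField (hTS : TowerSchanuel) {x : ℂ} (hx : x ∈ hullField hTS) : cexp x ∈ hullField hTS :=
  exp_mem_towerHullSet hx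

/-- … under all logarithms … -/
theorem mem_hullField_of_exp_mem (hTS : TowerSchanuel) {x : ℂ} (hx : cexp x ∈ hullField hTS) : x ∈ hullField hTS :=
  mem_towerHullSet_of_exp_mem hx

/-- … and is relatively algebraically closed in `ℂ`: the finitely many coefficients of a polynomial over `𝒯̂` generate
a hull field over which the root is algebraic, i.e. a curve point. -/
theorem mem_hullField_of_isAlgebraic (hTS : TowerSchanuel) {w : ℂ} (hw : IsAlgebraic ↥(hullField hTS) w) :
    w ∈ hullField hTS := by
  classical
  obtain ⟨p, hp0, hpw⟩ := hw
  set P : Polynomial ℂ := p.map (algebraMap ↥(hullField hTS) ℂ) with hP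
  have hP0 : P ≠ 0 := (Polynomial.map_ne_zero_iff (algebraMap ↥(hullField hTS) ℂ).injective).mpr hp0
  have hPw : P.eval w = 0 := by rw [hP, Polynomial.eval_map, ← Polynomial.aeval_def]; exact hpw
  have hcoeff : ∀ i, P.coeff i ∈ towerHullSet := fun i => by
    rw [hP, Polynomial.coeff_map]
    exact (p.coeff i).2
  -- the finite set of coefficients and its field
  set Y : Finset ℂ := (Finset.range (P.natDegree + 1)).image fun i => P.coeff i with hYdef
  have hY : (↑Y : Set ℂ) ⊆ towerHullSet := by
    intro x hx
    obtain ⟨i, -, rfl⟩ := Finset.mem_image.mp (Finset.mem_coe.mp hx)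
    exact hcoeff i
  set F : IntermediateField ℚ ℂ := adjoin ℚ ((↑Y : Set ℂ) ∪ cexp '' ↑Y) with hF
  have hmem : ∀ i : ℕ, P.coeff i ∈ F := by
    intro i
    by_cases hi : i < P.natDegree + 1
    · exact subset_adjoin ℚ _ (Or.inl (Finset.mem_coe.mpr
        (Finset.mem_image.mpr ⟨i, Finset.mem_range.mpr hi, rfl⟩)))
    · rw [Polynomial.coeff_eq_zero_of_natDegree_lt (by omega)]
      exact zero_mem F
  have hlift : P ∈ Polynomial.lifts (algebraMap ↥F ℂ) := by
    rw [Polynomial.lifts_iff_coeff_lifts]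
    intro i
    exact ⟨⟨P.coeff i, hmem i⟩, rfl⟩
  obtain ⟨q, hq⟩ := (Polynomial.mem_lifts P).mp hlift
  have hq0 : q ≠ 0 := by
    rintro rfl
    rw [Polynomial.map_zero] at hq
    exact hP0 hq.symm
  have hwF : IsAlgebraic ↥F w :=
    ⟨q, hq0, by rw [Polynomial.aeval_def, ← Polynomial.eval_map, hq]; exact hPw⟩
  exact curve_mem_towerHullSet hTS Y hY (curveCond_of_isAlgebraic Y hwF)

/-- **𝕃 ≤ 𝒯̂** (under `TowerSchanuel`): 1E's closed-form field lies inside 1H's tower hull. -/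
theorem closedFormField_le_hullField (hTS : TowerSchanuel) : closedFormField ≤ hullField hTS :=
  sInf_le ⟨fun _ hw => exp_mem_hullField hTS hw, fun _ hw => mem_hullField_of_exp_mem hTS hw,
    fun _ hw => mem_hullField_of_isAlgebraic hTS hw⟩

/-- Pointwise form: a closed-form number is a hull number. -/
theorem mem_towerHullSet_of_mem_closedFormField (hTS : TowerSchanuel) {x : ℂ} (hx : x ∈ closedFormField) :
    x ∈ towerHullSet :=
  closedFormField_le_hullField hTS hx

/-! ## 3. The hull-corank lemma -/

/-- A ℚ-free tuple strictly shorter than the ℚ-free `z` misses some coordinate of `z` in its span, which can be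
appended keeping ℚ-freeness. -/
theorem exists_snoc_linearIndependent {n a : ℕ} {z : Fin n → ℂ} (hz : LinearIndependent ℚ z) {ℓ : Fin a → ℂ}
    (hℓ : LinearIndependent ℚ ℓ) (han : a < n) :
    ∃ i, LinearIndependent ℚ (Fin.snoc ℓ (z i) : Fin (a + 1) → ℂ) := by
  haveI := FiniteDimensional.span_of_finite ℚ (Set.finite_range z)
  haveI := FiniteDimensional.span_of_finite ℚ (Set.finite_range ℓ)
  have hex : ∃ i, z i ∉ Submodule.span ℚ (range ℓ) := by
    by_contra hall
    push Not at hall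
    have hle : Submodule.span ℚ (range z) ≤ Submodule.span ℚ (range ℓ) :=
      Submodule.span_le.2 (by rintro _ ⟨j, rfl⟩; exact hall j)
    have h1 := finrank_span_eq_card hz
    have h2 := finrank_span_eq_card hℓ
    have h3 := Submodule.finrank_mono hle
    simp only [Fintype.card_fin] at h1 h2
    omega
  obtain ⟨i, hi⟩ := hex
  exact ⟨i, linearIndependent_finSnoc.2 ⟨hℓ, hi⟩⟩

/-- A ℚ-free tuple of length `≥ n` inside the span of the ℚ-free `z : Fin n → ℂ` spans it. -/
theorem mem_span_of_linearIndependent_of_le {n c : ℕ} {z : Fin n → ℂ} (hz : LinearIndependent ℚ z)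
    {w : Fin c → ℂ} (hw : LinearIndependent ℚ w) (hmem : ∀ j, w j ∈ Submodule.span ℚ (range z)) (hnc : n ≤ c) :
    ∀ i, z i ∈ Submodule.span ℚ (range w) := by
  haveI := FiniteDimensional.span_of_finite ℚ (Set.finite_range z)
  haveI := FiniteDimensional.span_of_finite ℚ (Set.finite_range w)
  have hle : Submodule.span ℚ (range w) ≤ Submodule.span ℚ (range z) := span_range_le hmem
  have h1 := finrank_span_eq_card hz
  have h2 := finrank_span_eq_card hw
  have h3 := Submodule.finrank_mono hle
  simp only [Fintype.card_fin] at h1 h2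
  have heq : Submodule.span ℚ (range w) = Submodule.span ℚ (range z) :=
    Submodule.eq_of_le_of_finrank_eq hle (by omega)
  intro i
  rw [heq]
  exact Submodule.subset_span ⟨i, rfl⟩

/-- Appending a coordinate of `z` to a tuple inside `span_ℚ z` stays inside `span_ℚ z`. -/
theorem snoc_mem_span {n c : ℕ} {z : Fin n → ℂ} {w : Fin c → ℂ} (hw : ∀ j, w j ∈ Submodule.span ℚ (range z))
    (i : Fin n) : ∀ j, (Fin.snoc w (z i) : Fin (c + 1) → ℂ) j ∈ Submodule.span ℚ (range z) := by
  intro j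
  refine Fin.lastCases ?_ (fun k => ?_) j
  · rw [Fin.snoc_last]; exact Submodule.subset_span ⟨i, rfl⟩
  · rw [Fin.snoc_castSucc]; exact hw k

/-- Appending a hull number to a hull tuple gives a hull tuple. -/
theorem snoc_mem_towerHullSet {c : ℕ} {w : Fin c → ℂ} (hw : ∀ j, w j ∈ towerHullSet) {g : ℂ}
    (hg : g ∈ towerHullSet) : ∀ j, (Fin.snoc w g : Fin (c + 1) → ℂ) j ∈ towerHullSet := by
  intro j
  refine Fin.lastCases ?_ (fun k => ?_) j
  · rw [Fin.snoc_last]; exact hg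
  · rw [Fin.snoc_castSucc]; exact hw k

/-- Under `TowerSchanuel`, Schanuel holds at every ℚ-free tuple inside the ℚ-span of a tuple of hull numbers
(all of them lie in the span of ONE free tower, by the landed merge lemma; then the landed hull theorem). -/
theorem le_trdeg_of_mem_span_hull (hTS : TowerSchanuel) {n c : ℕ} {z : Fin n → ℂ} (hz : LinearIndependent ℚ z)
    {w : Fin c → ℂ} (hw : ∀ j, w j ∈ towerHullSet) (hzw : ∀ i, z i ∈ Submodule.span ℚ (range w)) :
    (n : Cardinal) ≤ Algebra.trdeg ℚ ↥(adjoin ℚ (range z ∪ range (cexp ∘ z))) := by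
  obtain ⟨hPS, hRT⟩ := towerSchanuel_iff_structural.mp hTS
  obtain ⟨N, b, hb, htow, hwb⟩ := exists_tower_of_mem_towerHullSet hTS hw
  exact hull_of_product_of_relTower hPS hRT N b hb htow n z hz fun i => span_range_le hwb (hzw i)

/-- **THE HULL-CORANK LEMMA.**  Under `TowerSchanuel`, a ℚ-free SPAN-MINIMAL tuple `z` of rank `n` whose ℚ-span
contains a ℚ-free tuple `ℓ` of `a ≥ n - 2` HULL numbers satisfies Schanuel.  (Span-minimality bounds each base
field from below, a failure bounds the total from above; the sandwich puts each missing coordinate on a curve over a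
hull field, i.e. in the hull; the hull theorem then contradicts the failure.) -/
theorem le_trdeg_of_hullCorank_le_two (hTS : TowerSchanuel) {n : ℕ} {z : Fin n → ℂ} (hz : LinearIndependent ℚ z)
    (hmin : SpanMinimal n z) {a : ℕ} {ℓ : Fin a → ℂ} (hℓ : LinearIndependent ℚ ℓ)
    (hℓz : ∀ j, ℓ j ∈ Submodule.span ℚ (range z)) (hℓh : ∀ j, ℓ j ∈ towerHullSet) (hna : n ≤ a + 2) :
    (n : Cardinal) ≤ Algebra.trdeg ℚ ↥(adjoin ℚ (range z ∪ range (cexp ∘ z))) := by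
  by_contra hlt
  have hlt' : Algebra.trdeg ℚ ↥(adjoin ℚ (range z ∪ range (cexp ∘ z))) < (n : Cardinal) := not_le.mp hlt
  obtain ⟨t, htn, ht⟩ := exists_nat_lt_of_lt_natCast hlt'
  -- ONE HULL STEP inside the failing `z`: a free hull tuple `w ⊂ span z` of rank `c < n`, `n ≤ c + 2`, extends by a
  -- coordinate of `z` to a free HULL tuple of rank `c + 1`
  have step : ∀ {c : ℕ} {w : Fin c → ℂ}, LinearIndependent ℚ w → (∀ j, w j ∈ Submodule.span ℚ (range z)) →
      (∀ j, w j ∈ towerHullSet) → c < n → n ≤ c + 2 →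
      ∃ i, LinearIndependent ℚ (Fin.snoc w (z i) : Fin (c + 1) → ℂ) ∧
        ∀ j, (Fin.snoc w (z i) : Fin (c + 1) → ℂ) j ∈ towerHullSet := by
    intro c w hw hwz hwh hcn hnc
    obtain ⟨i, hi⟩ := exists_snoc_linearIndependent hz hw hcn
    refine ⟨i, hi, snoc_mem_towerHullSet hwh ?_⟩
    refine mem_towerHullSet_of_sandwich hTS hwh (hmin c w hcn hw hwz) ?_
    refine (trdeg_le_of_mem_span (snoc_mem_span hwz i)).trans ?_
    rw [ht]
    exact_mod_cast (by omega : t ≤ c + 1)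
  rcases Nat.lt_or_ge a n with han | han
  swap
  · exact hlt (le_trdeg_of_mem_span_hull hTS hz hℓh (mem_span_of_linearIndependent_of_le hz hℓ hℓz han))
  obtain ⟨i₁, hw₁, hw₁h⟩ := step hℓ hℓz hℓh han hna
  have hw₁z := snoc_mem_span hℓz i₁
  rcases Nat.lt_or_ge (a + 1) n with han₁ | han₁
  swap
  · exact hlt (le_trdeg_of_mem_span_hull hTS hz hw₁h (mem_span_of_linearIndependent_of_le hz hw₁ hw₁z han₁))
  obtain ⟨i₂, hw₂, hw₂h⟩ := step hw₁ hw₁z hw₁h han₁ (by omega)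
  exact hlt (le_trdeg_of_mem_span_hull hTS hz hw₂h
    (mem_span_of_linearIndependent_of_le hz hw₂ (snoc_mem_span hw₁z i₂) (by omega)))

end Summit.Schanuel.Schanuel.Theorems.RootDecomp1EHullCorank
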